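import Literature.Geometry.Kaehler.ComplexTorusCyclotomicAutomorphismOrderSeven
import HarnessLib

/-!
# Complex tori of dimension `3` with an automorphism of order `9`: `(X, u) ≅ (ℂ³/Φ(𝔞), ζ_9)`; `X` is simple iff
# `Φ` is one of the six primitive types, otherwise `X ∼ E × E × E` (`E` with CM by `ℚ(√−3)`); for `h(ℚ(ζ_9)) = 1`
# there are EXACTLY TWO such tori

Layer `Literature/Geometry/Kaehler`, namespace `Literature.Geometry.Kaehler.ComplexTorus`; lane `lit-hodgefound`
(Track 2 foundations library), Layer A2/A3 junction, row «A2-26(gi)» (self-proposed 2026-08-28, prover seat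
`lit-hodgefound-p10`, generation 32, FILE 5 of the generation) — the companion of FILE 4 (`…OrderSeven`) for the other
sextic cyclotomic field.  An endomorphism `u` of order `9 = 3²` of a `3`-dimensional complex torus `X` has `P_u = Φ_9`
(generation 31 FILE 2: prime-power order in rank `6 = φ(9)`), so `(X, u) ≅ (ℂ^Φ/Φ(𝔞), ζ_9)` for a CM type `Φ` of
`K = ℚ(ζ_9)` (FILE 1, Shimura's THEOREM 2).  The census of this generation (`CyclotomicCMTypeCensusSevenNine` §3–§4:
eight CM types of `ℚ(ζ_9)`; six primitive ones forming ONE family; the two imprimitive ones `{1,4,7}`, `{2,5,8}` —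
induced from `ℚ(ζ_3) = ℚ(√−3)` — forming the other) then gives, word for word as in FILE 4: `X` simple ⟺ `Φ`
primitive; `X` not simple ⟹ `X ∼ E × E × E` (FILE 4 §0, any sextic field); for `𝓞_{ℚ(ζ_9)}` principal
(`h(ℚ(ζ_9)) = 1`, this generation's `CyclotomicFieldsSevenNineClassNumber`; here the instance hypothesis
`[IsPrincipalIdealRing (𝓞 K)]` on the chosen model `K`): **`X ≅ X′ ⟺ (X simple ⟺ X′ simple)`** — EXACTLY TWO complex
tori of dimension `3` admit an automorphism of order `9`; order `18` is the same story (`−u` has order `9`), and a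
SIMPLE `3`-torus with an automorphism of order `9` or `18` IS the simple `ζ_9`-threefold.

WHAT IS PROVED (theorems only; no `def`, no instance, no named fact; net debt 0).
* §1 THE MODELS OF `ℚ(ζ_9)`: `exists_isSimple_and_not_isSimple_periodIso_nine`,
  **`isIsomorphic_periodIso_one_iff_isPrimitive_iff_nine`** (the finrank / existence / family lemmas are FILE 4's
  sextic generalities and the census, used inline).
* §2 THE PAIRS `(X, u)`, `orderOf u = 9`, `dim X = 3`: `charpoly_eq_cyclotomic_nine_of_orderOf`,
  `isAbelianVariety_of_orderOf_eq_nine`, **`exists_isIsogenous_cube_of_orderOf_eq_nine`**,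
  **`isIsomorphic_of_orderOf_eq_nine_of_isSimple`**, **`isIsomorphic_of_orderOf_eq_nine_of_not_isSimple`**,
  **`isIsomorphic_iff_of_orderOf_eq_nine`**, `isIsomorphic_periodIso_one_of_orderOf_eq_nine`.
* §3 ORDER `18`: `orderOf_neg_eq_nine_of_orderOf_eq_eighteen`, `isIsomorphic_iff_of_orderOf_eq_nine_or_eighteen`.
* §4 **`IsSimple.isIsomorphic_of_orderOf_eq_nine_or_eighteen`**.

Sources.  G. Shimura, *Abelian Varieties with Complex Multiplication and Modular Functions* (1998): §6.1 Thm. 2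
p. 41, §6.2 Thm. 3 pp. 42–44, §7.4 Prop. 17 p. 58, §8.2 Prop. 26 p. 69, §8.4 Example (1) p. 65 («We can similarly
treat the case where `F` is cyclic over `Q`»; held chunk p0085).  Ch. Birkenhake, H. Lange, *Complex Abelian
Varieties*, 2nd ed. (2004), §13.3 — not held (acq-10211), locator as cited by this lane's earlier rows.  L. C.
Washington, *Introduction to Cyclotomic Fields* (1997), Thm. 11.1 (`h(ℚ(ζ_9)) = 1`) for the class-number input.

## References

* [Shimura1998] G. Shimura, *Abelian Varieties with Complex Multiplication and Modular Functions*, Princeton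
  Univ. Press (1998), §6.1 Thm. 2 p. 41, §6.2 Thm. 3 pp. 42–44, §7.4 Prop. 17 p. 58, §8.2 Prop. 26 p. 69, §8.4
  Example (1) p. 65.
* [BirkenhakeLange2004] Ch. Birkenhake, H. Lange, *Complex Abelian Varieties*, 2nd ed., Grundlehren 302 (2004),
  §13.3.
* [Washington1997] L. C. Washington, *Introduction to Cyclotomic Fields*, 2nd ed., GTM 83 (1997), Thm. 11.1.
-/

noncomputable section

open scoped Classical nonZeroDivisors NumberField Manifold ContDiff
open NumberField Module Polynomial

namespace Literature.Geometry.Kaehler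

namespace ComplexTorus

-- `open scoped`: the tree's action of `Aut(ℂ)` on `Hom(K, ℂ)` by composition (`ringEquivCompAction`) is a scoped instance
open scoped Literature.NumberTheory.ComplexMultiplication
open Literature.AlgebraicGeometry.Motives (CMType)
open Literature.NumberTheory.ComplexMultiplication (inducedCMType)
open Literature.NumberTheory.ComplexMultiplication.CMTypeLattice (periodIso isSimple_periodIso_iff_isPrimitive)
open Literature.AlgebraicGeometry.ComplexMultiplication.CyclotomicCMTypeResidueSets (IsAutTransform)
open Literature.AlgebraicGeometry.ComplexMultiplication.CyclotomicCMTypeCensusSevenNine (isAutTransform_iff_nine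
  ncard_isPrimitive_nine ncard_not_isPrimitive_nine)
-- `CMTypeLattice.mulMatrix I a` (multiplication by `a ∈ 𝓞 K` on the ideal `I`) is spelled with its namespace below:
-- the elliptic-curve files in the import cone declare a `ComplexTorus.mulMatrix` of their own.
open Literature.NumberTheory.ComplexMultiplication (CMTypeLattice.mulMatrix)

/-! ### §1 The models `ℂ³/Φ(𝔞)` of `ℚ(ζ_9)`: simple iff `Φ` primitive; two isomorphism classes for `𝓞` principal -/

section Models

variable {K : Type} [Field K] [NumberField K] [IsCyclotomicExtension {9} ℚ K]

omit [IsCyclotomicExtension {9} ℚ K] in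
/-- A number field has a complex embedding (to read primitivity at). [folklore] -/
private theorem nonempty_embedding₃₂ : Nonempty (K →+* ℂ) := inferInstance

/-- **Both kinds occur for `ℚ(ζ_9)`**: there is a simple `ℂ³/Φ(𝔞)` (six of the eight types are primitive) and a
non-simple `ℂ³/Ψ(𝔞)` (the two imprimitive types `{1,4,7}`, `{2,5,8}`). [cite: Shimura1998, §8.4 Example (1) p. 65, §8.2 Prop. 26 p. 69] -/
theorem exists_isSimple_and_not_isSimple_periodIso_nine (I : (FractionalIdeal (𝓞 K)⁰ K)ˣ) :
    ∃ Φ Ψ : CMType K, ComplexTorus.IsSimple (periodIso Φ I) ∧ ¬ ComplexTorus.IsSimple (periodIso Ψ I) := by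
  obtain ⟨φ₀⟩ := nonempty_embedding₃₂ (K := K)
  have hne : {Φ : CMType K | Literature.NumberTheory.ComplexMultiplication.IsPrimitive (ℂ ≃+* ℂ) Φ.1 φ₀}.Nonempty :=
    Set.nonempty_of_ncard_ne_zero (by rw [ncard_isPrimitive_nine φ₀]; norm_num)
  have hne' : {Φ : CMType K | ¬ Literature.NumberTheory.ComplexMultiplication.IsPrimitive (ℂ ≃+* ℂ) Φ.1 φ₀}.Nonempty :=
    Set.nonempty_of_ncard_ne_zero (by rw [ncard_not_isPrimitive_nine φ₀]; norm_num)
  obtain ⟨Φ, hΦ⟩ := hne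
  obtain ⟨Ψ, hΨ⟩ := hne'
  exact ⟨Φ, Ψ, (isSimple_periodIso_iff_isPrimitive Φ I φ₀).2 hΦ,
    fun h ↦ hΨ ((isSimple_periodIso_iff_isPrimitive Ψ I φ₀).1 h)⟩

variable {ζ : K} (hζ : IsPrimitiveRoot ζ 9)

include hζ in
/-- **THE MODELS `ℂ³/Φ(𝓞)` OF `ℚ(ζ_9)` ARE TWO TORI** (`𝓞` principal): `ℂ³/Φ(𝓞) ≅ ℂ³/Ψ(𝓞)` as complex tori iff `Φ`
and `Ψ` are both primitive or both imprimitive (equivalently both models simple or both not) — «same family ⟹ same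
torus» (generation 31 FILE 6), the census, and Prop. 26. [cite: Shimura1998, §7.4 Prop. 17 p. 58, §8.2 Prop. 26 p. 69, §8.4 Example (1) p. 65]
[cite: BirkenhakeLange2004, §13.3] -/
theorem isIsomorphic_periodIso_one_iff_isPrimitive_iff_nine [IsPrincipalIdealRing (𝓞 K)] (Φ Ψ : CMType K)
    (φ₀ : K →+* ℂ) :
    IsIsomorphic (periodIso Φ (1 : (FractionalIdeal (𝓞 K)⁰ K)ˣ)) (periodIso Ψ 1) ↔
      (Literature.NumberTheory.ComplexMultiplication.IsPrimitive (ℂ ≃+* ℂ) Φ.1 φ₀ ↔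
        Literature.NumberTheory.ComplexMultiplication.IsPrimitive (ℂ ≃+* ℂ) Ψ.1 φ₀) := by
  rw [← isSimple_periodIso_iff_isPrimitive Φ 1 φ₀, ← isSimple_periodIso_iff_isPrimitive Ψ 1 φ₀]
  constructor
  · intro h
    exact h.isSimple_iff
  · intro h
    have hfam : IsAutTransform Φ Ψ := (isAutTransform_iff_nine Φ Ψ φ₀).2 (by
      rwa [← isSimple_periodIso_iff_isPrimitive Φ 1 φ₀, ← isSimple_periodIso_iff_isPrimitive Ψ 1 φ₀])
    obtain ⟨g, hg, hg', -⟩ := exists_iso_periodIso_one_of_isAutTransform hζ hfam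
    exact ⟨g, hg, hg'⟩

end Models

/-! ### §2 The pairs `(X, u)`: `3`-dimensional complex tori with an endomorphism of order `9` -/

section Nine

variable {ι : Type} [Fintype ι] [DecidableEq ι] {E : Type} [NormedAddCommGroup E] [NormedSpace ℂ E]
  {P : (ι → ℝ) ≃L[ℝ] E} {ι' : Type} [Fintype ι'] [DecidableEq ι'] {E' : Type} [NormedAddCommGroup E']
  [NormedSpace ℂ E'] {P' : (ι' → ℝ) ≃L[ℝ] E'}

/-- `9 = 3²` is a prime power. [folklore] -/
private theorem isPrimePow_nine₃₂ : IsPrimePow 9 :=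
  (isPrimePow_nat_iff 9).2 ⟨3, 2, Nat.prime_three, by norm_num, by norm_num⟩

/-- `φ(9) = 6`. [folklore] -/
private theorem totient_nine₃₂ : Nat.totient 9 = 6 := by decide

omit [DecidableEq ι] in
/-- **Order `9` on a `3`-dimensional complex torus forces `P_u = Φ_9`** (`9 = 3²` a prime power, `rk = 6 = φ(9)`,
generation 31 FILE 2). [cite: BirkenhakeLange2004, §13.3] [cite: Lange2023AbelianVarietiesComplex, §2.4.5 Exercise (10), p0126] -/
theorem charpoly_eq_cyclotomic_nine_of_orderOf [DecidableEq ι] {A : Matrix ι ι ℤ} (hord : orderOf A = 9)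
    (hdim : finrank ℂ E = 3) (P : (ι → ℝ) ≃L[ℝ] E) : A.charpoly = cyclotomic 9 ℤ :=
  charpoly_eq_cyclotomic_of_orderOf_eq_of_finrank P isPrimePow_nine₃₂ hord (by rw [hdim, totient_nine₃₂])

/-- **A `3`-dimensional complex torus with an endomorphism of order `9` is an abelian variety** (it is `ℂ³/Φ(𝔞)` for
`ℚ(ζ_9)`). [cite: Shimura1998, §6.2 Thm. 3, p. 42] [cite: BirkenhakeLange2004, §13.3] -/
theorem isAbelianVariety_of_orderOf_eq_nine {A : Matrix ι ι ℤ} (hA : A ∈ endRingInt P) (hord : orderOf A = 9)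
    (hdim : finrank ℂ E = 3) : IsAbelianVariety P :=
  haveI : NeZero (9 : ℕ) := ⟨by norm_num⟩
  isAbelianVariety_of_orderOf_eq hA isPrimePow_nine₃₂ hord (by rw [hdim, totient_nine₃₂])

set_option backward.isDefEq.respectTransparency false in -- Mathlib's instance
-- `IsCyclotomicExtension {9} ℚ (CyclotomicField 9 ℚ)` is keyed on `CyclotomicField.algebra`, the goal on
-- `DivisionRing.toRatAlgebra` (same workaround as generation 31 FILE 1 `isAbelianVariety_of_charpoly_eq_cyclotomic`)
/-- **A NON-SIMPLE `3`-TORUS WITH AN AUTOMORPHISM OF ORDER `9` IS ISOGENOUS TO `E × E × E`**, `E = ℂ/Φ₀(𝔞₀)` a CM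
elliptic curve of an imaginary quadratic subfield `K₀ ⊂ ℚ(ζ_9)` (`= ℚ(√−3) = ℚ(ζ_3)`), for every ideal `𝔞₀` of `K₀`.
[cite: Shimura1998, §6.1 Thm. 2 p. 41, §6.2 Thm. 3 pp. 42–44, §8.2 Prop. 26 p. 69] [cite: BirkenhakeLange2004, §13.3] -/
theorem exists_isIsogenous_cube_of_orderOf_eq_nine {A : Matrix ι ι ℤ} (hA : A ∈ endRingInt P)
    (hord : orderOf A = 9) (hdim : finrank ℂ E = 3) (hns : ¬ ComplexTorus.IsSimple P) :
    ∃ (K₀ : IntermediateField ℚ (CyclotomicField 9 ℚ)) (Φ₀ : CMType K₀), finrank ℚ K₀ = 2 ∧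
      ∀ I₀ : (FractionalIdeal (𝓞 K₀)⁰ K₀)ˣ,
        ComplexTorus.IsSimple (periodIso Φ₀ I₀) ∧ IsIsogenous P (powPeriod (periodIso Φ₀ I₀) 3) := by
  have hζ := IsCyclotomicExtension.zeta_spec 9 ℚ (CyclotomicField 9 ℚ)
  obtain ⟨Φ, I, e, he, he₂, -⟩ :=
    exists_cmType_ideal_iso_of_charpoly_eq_cyclotomic hζ hA (charpoly_eq_cyclotomic_nine_of_orderOf hord hdim P)
  have hns' : ¬ ComplexTorus.IsSimple (periodIso Φ I) := fun h ↦ hns ((IsIsomorphic.isSimple_iff ⟨e, he, he₂⟩).2 h)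
  obtain ⟨K₀, Φ₀, h2, -, hI⟩ := exists_isIsogenous_cube_of_not_isSimple
    (by rw [IsCyclotomicExtension.Rat.finrank 9 (CyclotomicField 9 ℚ)]; decide) Φ I hns'
  exact ⟨K₀, Φ₀, h2, fun I₀ ↦ ⟨(hI I₀).1,
    IsIsogenous.trans _ _ _ (IsIsomorphic.isIsogenous ⟨e, he, he₂⟩) (hI I₀).2⟩⟩

variable (K : Type) [Field K] [NumberField K] [IsCyclotomicExtension {9} ℚ K]

/-- **ALL SIMPLE `3`-DIMENSIONAL COMPLEX TORI WITH AN ENDOMORPHISM OF ORDER `9` ARE ISOMORPHIC** (read through any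
model `K` of `ℚ(ζ_9)` with `𝓞_K` principal — `h(ℚ(ζ_9)) = 1`): both are `ℂ³/Φ(𝓞)`, `ℂ³/Φ′(𝓞)` with `Φ, Φ′` PRIMITIVE
(simple ⟺ primitive), and the primitive types of `ℚ(ζ_9)` form ONE family, so «same family ⟹ same torus».
[cite: Shimura1998, §7.4 Prop. 17 p. 58, §8.2 Prop. 26 p. 69, §8.4 Example (1) p. 65] [cite: BirkenhakeLange2004, §13.3] -/
theorem isIsomorphic_of_orderOf_eq_nine_of_isSimple [IsPrincipalIdealRing (𝓞 K)] (hX : ComplexTorus.IsSimple P)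
    {A : Matrix ι ι ℤ} (hA : A ∈ endRingInt P) (hord : orderOf A = 9) (hdim : finrank ℂ E = 3)
    (hX' : ComplexTorus.IsSimple P') {A' : Matrix ι' ι' ℤ} (hA' : A' ∈ endRingInt P') (hord' : orderOf A' = 9)
    (hdim' : finrank ℂ E' = 3) : IsIsomorphic P P' := by
  obtain ⟨ζ, hζ⟩ : ∃ ζ : K, IsPrimitiveRoot ζ 9 :=
    IsCyclotomicExtension.exists_isPrimitiveRoot ℚ K (Set.mem_singleton 9) (by norm_num)
  have hP := charpoly_eq_cyclotomic_nine_of_orderOf hord hdim P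
  have hP' := charpoly_eq_cyclotomic_nine_of_orderOf hord' hdim' P'
  obtain ⟨Φ, I, e, he, he₂, hcomm⟩ := exists_cmType_ideal_iso_of_charpoly_eq_cyclotomic hζ hA hP
  obtain ⟨Φ', I', e', he', he₂', hcomm'⟩ := exists_cmType_ideal_iso_of_charpoly_eq_cyclotomic hζ hA' hP'
  have hS : ComplexTorus.IsSimple (periodIso Φ I) := (IsIsomorphic.isSimple_iff ⟨e, he, he₂⟩).1 hX
  have hS' : ComplexTorus.IsSimple (periodIso Φ' I') := (IsIsomorphic.isSimple_iff ⟨e', he', he₂'⟩).1 hX'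
  obtain ⟨φ₀⟩ := nonempty_embedding₃₂ (K := K)
  have hfam : IsAutTransform Φ Φ' := (isAutTransform_iff_nine Φ Φ' φ₀).2
    (iff_of_true ((isSimple_periodIso_iff_isPrimitive Φ I φ₀).1 hS) ((isSimple_periodIso_iff_isPrimitive Φ' I' φ₀).1 hS'))
  exact isIsomorphic_of_isAutTransform hζ hA hP hA' hP' e he hcomm e' he' he₂' hcomm' hfam

/-- **ALL NON-SIMPLE `3`-DIMENSIONAL COMPLEX TORI WITH AN ENDOMORPHISM OF ORDER `9` ARE ISOMORPHIC** (`𝓞_{ℚ(ζ_9)}`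
principal): their types are the two IMPRIMITIVE ones, which form one family. [cite: Shimura1998, §7.4 Prop. 17 p. 58, §8.2 Prop. 26 p. 69, §8.4 Example (1) p. 65]
[cite: BirkenhakeLange2004, §13.3] -/
theorem isIsomorphic_of_orderOf_eq_nine_of_not_isSimple [IsPrincipalIdealRing (𝓞 K)]
    (hX : ¬ ComplexTorus.IsSimple P) {A : Matrix ι ι ℤ} (hA : A ∈ endRingInt P) (hord : orderOf A = 9)
    (hdim : finrank ℂ E = 3) (hX' : ¬ ComplexTorus.IsSimple P') {A' : Matrix ι' ι' ℤ} (hA' : A' ∈ endRingInt P')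
    (hord' : orderOf A' = 9) (hdim' : finrank ℂ E' = 3) : IsIsomorphic P P' := by
  obtain ⟨ζ, hζ⟩ : ∃ ζ : K, IsPrimitiveRoot ζ 9 :=
    IsCyclotomicExtension.exists_isPrimitiveRoot ℚ K (Set.mem_singleton 9) (by norm_num)
  have hP := charpoly_eq_cyclotomic_nine_of_orderOf hord hdim P
  have hP' := charpoly_eq_cyclotomic_nine_of_orderOf hord' hdim' P'
  obtain ⟨Φ, I, e, he, he₂, hcomm⟩ := exists_cmType_ideal_iso_of_charpoly_eq_cyclotomic hζ hA hP
  obtain ⟨Φ', I', e', he', he₂', hcomm'⟩ := exists_cmType_ideal_iso_of_charpoly_eq_cyclotomic hζ hA' hP'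
  have hS : ¬ ComplexTorus.IsSimple (periodIso Φ I) := fun h ↦ hX ((IsIsomorphic.isSimple_iff ⟨e, he, he₂⟩).2 h)
  have hS' : ¬ ComplexTorus.IsSimple (periodIso Φ' I') := fun h ↦ hX' ((IsIsomorphic.isSimple_iff ⟨e', he', he₂'⟩).2 h)
  obtain ⟨φ₀⟩ := nonempty_embedding₃₂ (K := K)
  have hfam : IsAutTransform Φ Φ' := (isAutTransform_iff_nine Φ Φ' φ₀).2
    (iff_of_false (fun h ↦ hS ((isSimple_periodIso_iff_isPrimitive Φ I φ₀).2 h))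
      (fun h ↦ hS' ((isSimple_periodIso_iff_isPrimitive Φ' I' φ₀).2 h)))
  exact isIsomorphic_of_isAutTransform hζ hA hP hA' hP' e he hcomm e' he' he₂' hcomm' hfam

/-- **EXACTLY TWO COMPLEX TORI OF DIMENSION `3` ADMIT AN AUTOMORPHISM OF ORDER `9`** (`𝓞_{ℚ(ζ_9)}` principal): two
`3`-dimensional complex tori `X`, `X′` carrying endomorphisms of order `9` are isomorphic iff both are simple or both
are not. [cite: Shimura1998, §7.4 Prop. 17 p. 58, §8.2 Prop. 26 p. 69, §8.4 Example (1) p. 65] [cite: BirkenhakeLange2004, §13.3] -/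
theorem isIsomorphic_iff_of_orderOf_eq_nine [IsPrincipalIdealRing (𝓞 K)] {A : Matrix ι ι ℤ}
    (hA : A ∈ endRingInt P) (hord : orderOf A = 9) (hdim : finrank ℂ E = 3) {A' : Matrix ι' ι' ℤ}
    (hA' : A' ∈ endRingInt P') (hord' : orderOf A' = 9) (hdim' : finrank ℂ E' = 3) :
    IsIsomorphic P P' ↔ (ComplexTorus.IsSimple P ↔ ComplexTorus.IsSimple P') := by
  refine ⟨fun h ↦ h.isSimple_iff, fun h ↦ ?_⟩
  by_cases hX : ComplexTorus.IsSimple P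
  · exact isIsomorphic_of_orderOf_eq_nine_of_isSimple K hX hA hord hdim (h.1 hX) hA' hord' hdim'
  · exact isIsomorphic_of_orderOf_eq_nine_of_not_isSimple K hX hA hord hdim (fun h' ↦ hX (h.2 h')) hA' hord' hdim'

variable {K}

/-- `dim_ℂ ℂ^Φ = 3` for a CM type `Φ` of `ℚ(ζ_9)` (`2 dim = φ(9) = 6`). [cite: Shimura1998, §6.2 Thm. 3, p. 42] -/
private theorem finrank_pi_cmType_nine (Φ : CMType K) : finrank ℂ (Φ.1 → ℂ) = 3 := by
  have h := two_mul_finrank_pi_cmType (d := 9) (K := K) Φ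
  rw [totient_nine₃₂] at h
  omega

variable (K) in
/-- **`X ≅ ℂ³/Φ₀(𝓞_{ℚ(ζ_9)})` for EVERY type `Φ₀` of the matching kind** (`𝓞` principal): a `3`-torus `X` with an
endomorphism of order `9` is isomorphic to the model `ℂ³/Φ₀(𝓞)` as soon as `X` and the model are both simple or both
non-simple — not only to the model of its own type. [cite: Shimura1998, §7.4 Prop. 17 p. 58, §8.4 Example (1) p. 65]
[cite: BirkenhakeLange2004, §13.3] -/
theorem isIsomorphic_periodIso_one_of_orderOf_eq_nine [IsPrincipalIdealRing (𝓞 K)] {ζ : K}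
    (hζ : IsPrimitiveRoot ζ 9) (Φ₀ : CMType K) {A : Matrix ι ι ℤ} (hA : A ∈ endRingInt P) (hord : orderOf A = 9)
    (hdim : finrank ℂ E = 3)
    (h : ComplexTorus.IsSimple P ↔ ComplexTorus.IsSimple (periodIso Φ₀ (1 : (FractionalIdeal (𝓞 K)⁰ K)ˣ))) :
    IsIsomorphic P (periodIso Φ₀ (1 : (FractionalIdeal (𝓞 K)⁰ K)ˣ)) :=
  (isIsomorphic_iff_of_orderOf_eq_nine K hA hord hdim (mulMatrix_toInteger_mem_endRingInt hζ Φ₀ 1)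
    (orderOf_mulMatrix_toInteger hζ Φ₀ 1) (finrank_pi_cmType_nine Φ₀)).2 h

/-! ### §3 Order `18`: `−u` has order `9` -/

/-- **An endomorphism of order `18` of a `3`-dimensional complex torus has `−u` of order `9`** (generation 31
FILE 9: `P_u = Φ_18` is forced in rank `6 = φ(18)`, and `−ζ_18` is a primitive `9`-th root of unity).
[cite: BirkenhakeLange2004, §13.3] [cite: BambergCairnsKilminster2003, Thm. 1] -/
theorem orderOf_neg_eq_nine_of_orderOf_eq_eighteen {A : Matrix ι ι ℤ} (hA : A ∈ endRingInt P)
    (hord : orderOf A = 18) (hdim : finrank ℂ E = 3) : orderOf (-A) = 9 := by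
  have h := orderOf_neg_of_orderOf_eq_two_mul_prime_pow Nat.prime_three (by norm_num) 1 hA
    (by rw [hord]; norm_num) (by rw [hdim]; decide)
  rw [h]
  norm_num

/-- An endomorphism of order `9` or `18` of a `3`-torus yields one of order `9` (`u` itself or `−u`).
[cite: BirkenhakeLange2004, §13.3] -/
theorem exists_orderOf_eq_nine_of_orderOf_eq_nine_or_eighteen {A : Matrix ι ι ℤ} (hA : A ∈ endRingInt P)
    (hord : orderOf A = 9 ∨ orderOf A = 18) (hdim : finrank ℂ E = 3) :
    ∃ B : Matrix ι ι ℤ, B ∈ endRingInt P ∧ orderOf B = 9 := by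
  rcases hord with h | h
  · exact ⟨A, hA, h⟩
  · exact ⟨-A, Subring.neg_mem _ hA, orderOf_neg_eq_nine_of_orderOf_eq_eighteen hA h hdim⟩

/-- **The classification for orders `9` and `18` together** (`𝓞_{ℚ(ζ_9)}` principal): two `3`-dimensional complex
tori carrying endomorphisms of order `9` or `18` are isomorphic iff both are simple or both are not.
[cite: Shimura1998, §7.4 Prop. 17 p. 58, §8.4 Example (1) p. 65] [cite: BirkenhakeLange2004, §13.3] -/
theorem isIsomorphic_iff_of_orderOf_eq_nine_or_eighteen [IsPrincipalIdealRing (𝓞 K)] {A : Matrix ι ι ℤ}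
    (hA : A ∈ endRingInt P) (hord : orderOf A = 9 ∨ orderOf A = 18) (hdim : finrank ℂ E = 3) {A' : Matrix ι' ι' ℤ}
    (hA' : A' ∈ endRingInt P') (hord' : orderOf A' = 9 ∨ orderOf A' = 18) (hdim' : finrank ℂ E' = 3) :
    IsIsomorphic P P' ↔ (ComplexTorus.IsSimple P ↔ ComplexTorus.IsSimple P') := by
  obtain ⟨B, hB, hB9⟩ := exists_orderOf_eq_nine_of_orderOf_eq_nine_or_eighteen hA hord hdim
  obtain ⟨B', hB', hB9'⟩ := exists_orderOf_eq_nine_of_orderOf_eq_nine_or_eighteen hA' hord' hdim'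
  exact isIsomorphic_iff_of_orderOf_eq_nine K hB hB9 hdim hB' hB9' hdim'

/-! ### §4 Simple threefolds: one torus for the orders `9` and `18` -/

/-- **A SIMPLE `3`-DIMENSIONAL COMPLEX TORUS WITH AN AUTOMORPHISM OF ORDER `9` OR `18` IS THE SIMPLE
`ζ_9`-THREEFOLD**: any two simple `3`-tori carrying endomorphisms of order `9` or `18` are isomorphic (`𝓞_{ℚ(ζ_9)}`
principal).  The orders met on simple `3`-tori are `1, 2, 3, 4, 6, 7, 9, 14, 18` (the tree's
`IsSimple.orderOf_mem_of_card_eq_six`). [cite: Shimura1998, §7.4 Prop. 17 p. 58, §8.2 Prop. 26 p. 69, §8.4 Example (1) p. 65]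
[cite: BirkenhakeLange2004, §13.3] -/
theorem IsSimple.isIsomorphic_of_orderOf_eq_nine_or_eighteen [IsPrincipalIdealRing (𝓞 K)]
    (hX : ComplexTorus.IsSimple P) {A : Matrix ι ι ℤ} (hA : A ∈ endRingInt P) (hord : orderOf A = 9 ∨ orderOf A = 18)
    (hdim : finrank ℂ E = 3) (hX' : ComplexTorus.IsSimple P') {A' : Matrix ι' ι' ℤ} (hA' : A' ∈ endRingInt P')
    (hord' : orderOf A' = 9 ∨ orderOf A' = 18) (hdim' : finrank ℂ E' = 3) : IsIsomorphic P P' :=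
  (ComplexTorus.isIsomorphic_iff_of_orderOf_eq_nine_or_eighteen (K := K) hA hord hdim hA' hord' hdim').2
    (iff_of_true hX hX')

end Nine

end ComplexTorus

end Literature.Geometry.Kaehler

end
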